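import Mathlib

/-!
# Crux `BirGappedPhaseReductionR` (item `stmt-HubbardSuperconductivity-14846`): no finitely supported table reproduces an affine-in-cosine two-slice weight

Negative-side lemma of the standing disprover of crux 4R of route BalabanIR
(`BirGappedPhaseReductionR := BirComplexStableXYR → BirBdGPhaseCoercivity → BirGroundStateAverageLRO`).
The restated engine 2R is typed over FINITELY SUPPORTED Fourier tables `c : (W_r → ℤ) →₀ ℂ` and weights of
the exact form `exp(-K Σ_s F_c(θ|_{s+W_r}))`, and its conclusion (`Z ≠ 0 ∧ 1/2 ≤ Re(N/Z)`) carries NO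
quantitative margin.  The informal content of 4R is that the fermion-induced pair-phase weight of the gapped
Hubbard window "is `K·Σ_s F(θ|window)` (+ exponentially small tails)".  This file records, in the simplest
instance, why the parenthesis cannot be dropped — so that a proof of 4R USING the typed 2R needs an
approximation step that the margin-free conclusion of 2R cannot absorb (the reduction must re-prove a
quantitative engine, or 2R must be re-typed over summable tables with a margin):

* `cexp_ne_affine_cos` — for `B ≠ 0` there is NO function `F : ℂ → ℂ` of the form "finite exponential sum"
  — indeed no finitely supported table `c : ℤ →₀ ℂ` — with `exp(F(α)) = A + B cos α` for all REAL `α`: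
  both sides are entire, they would agree on `ℂ` (identity theorem), and `A + B cos` has a complex zero
  (`Complex.cos` is surjective) while `exp` has none.

Dictionary (informal; only the statement above is formalised).  For ONE gapped pairing site (or block) with the
gauge-covariant coupling `H(θ) = U(θ/2) H(0) U(θ/2)†`, `U(χ) = e^{iχN}`, the two-slice kernel of the Trotterised
weight is `k(α) = Tr[e^{-aH(0)} U(α/2) e^{-aH(0)} U(-α/2)] = Σ_{N,N'} w_{NN'} e^{i(N-N')α/2}`, a finite
trigonometric polynomial in the phase jump `α = θ_τ - θ_{τ+1}`; in the even sector `{|0⟩, |↑↓⟩}` of one site it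
is `A + B cos α` with `B = 2|⟨0|e^{-aH(0)}|↑↓⟩|² > 0` as soon as the pairing amplitude and `a` are non-zero.
By the theorem, `k = e^{-K F_c}` with `c` finitely supported is impossible: `-log k` is real-analytic and
`2π`-periodic on `ℝ` (for `A > |B|`) but has infinitely many non-zero Fourier coefficients (exponential, not
finite, tails).  The only kernels of the typed form that are themselves trigonometric polynomials are the
monomials `B e^{imα}` (pure boosts).  This is triage note G1 of the rev-0 crux (TRIAGE-r1-2) made a theorem.

Standing disprover refuter-cdisprove-stmt-HubbardSuperconductivity-14846-0, 2026-08-16; work file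
`Cruxes/BirGappedPhaseReductionR/Disproof.lean`.  NO definition is introduced; nothing asserts a `Theses` decl.
References: identity theorem for analytic functions (Mathlib `AnalyticOnNhd.eqOn_zero_of_preconnected_of_frequently_eq_zero`);
P. G. de Gennes, *Superconductivity of Metals and Alloys* (1966) Ch. 4 (pair-occupation representation). [folklore]
-/

noncomputable section

namespace Summit.HubbardSuperconductivity.HubbardSuperconductivity.Theorems.BirGappedPhaseReductionR.Negative

open Complex Filter Set
open scoped Topology

/-- `A + B cos` has a complex zero when `B ≠ 0`. [folklore] -/
theorem exists_affine_cos_eq_zero (A B : ℂ) (hB : B ≠ 0) : ∃ z : ℂ, A + B * Complex.cos z = 0 := by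
  obtain ⟨z, hz⟩ := Complex.cos_surjective (-A / B)
  refine ⟨z, ?_⟩
  rw [hz]; field_simp; ring

/-- the real points `1/(n+1)` accumulate at `0` inside `ℂ ∖ {0}`. [folklore] -/
theorem frequently_ofReal_nhdsWithin_zero {p : ℂ → Prop} (hp : ∀ x : ℝ, p (x : ℂ)) :
    ∃ᶠ z in 𝓝[≠] (0 : ℂ), p z := by
  have ht : Tendsto (fun n : ℕ => (((1 : ℝ) / ((n : ℝ) + 1) : ℝ) : ℂ)) atTop (𝓝[≠] (0 : ℂ)) := by
    rw [tendsto_nhdsWithin_iff]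
    refine ⟨?_, Eventually.of_forall fun n => ?_⟩
    · have h := (Complex.continuous_ofReal.tendsto 0).comp tendsto_one_div_add_atTop_nhds_zero_nat
      rw [Complex.ofReal_zero] at h
      exact h
    · simp only [mem_compl_iff, mem_singleton_iff, Complex.ofReal_eq_zero, one_div, inv_eq_zero]
      positivity
  exact ht.frequently (Eventually.of_forall fun n => hp _).frequently

/-- **No finitely supported table reproduces an affine-in-cosine weight.**  If `B ≠ 0`, no finitely supported
`c : ℤ →₀ ℂ` satisfies `exp(Σ_n c_n e^{inα}) = A + B cos α` for all real `α`. [folklore] -/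
theorem cexp_ne_affine_cos (c : ℤ →₀ ℂ) (A B : ℂ) (hB : B ≠ 0) :
    ¬ ∀ α : ℝ, cexp (c.sum (fun n a => a * cexp (I * (n : ℂ) * (α : ℂ)))) = A + B * Complex.cos (α : ℂ) := by
  intro h
  set g : ℂ → ℂ := fun z => cexp (c.sum (fun n a => a * cexp (I * (n : ℂ) * z))) - (A + B * Complex.cos z)
    with hg
  have hdiff : Differentiable ℂ g := by
    show Differentiable ℂ fun z =>
      cexp (∑ n ∈ c.support, c n * cexp (I * (n : ℂ) * z)) - (A + B * Complex.cos z)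
    fun_prop
  have hana : AnalyticOnNhd ℂ g univ := hdiff.differentiableOn.analyticOnNhd isOpen_univ
  have hzero : ∀ x : ℝ, g (x : ℂ) = 0 := fun x => by
    simp only [hg, h x, sub_self]
  have hfreq : ∃ᶠ z in 𝓝[≠] (0 : ℂ), g z = 0 := frequently_ofReal_nhdsWithin_zero hzero
  have hg0 : EqOn g 0 univ :=
    hana.eqOn_zero_of_preconnected_of_frequently_eq_zero isPreconnected_univ (mem_univ 0) hfreq
  obtain ⟨z₀, hz₀⟩ := exists_affine_cos_eq_zero A B hB
  have h0 : g z₀ = 0 := hg0 (mem_univ z₀)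
  rw [hg] at h0
  simp only [hz₀, sub_zero] at h0
  exact Complex.exp_ne_zero _ h0

end Summit.HubbardSuperconductivity.HubbardSuperconductivity.Theorems.BirGappedPhaseReductionR.Negative
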